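import Summits.BirchSwinnertonDyer.Rank1Residual.O6.X3KatoMemberBoundExactCount
import Literature.NumberTheory.EllipticCurves.Kato2004.HullDescentNonvanishingProofs
import HarnessLib

/-!
# O6 / O5 / B8: the EXACT RANK-ONE count at an ARBITRARY member, `v_p ℒ(W) = m(W) + ord_p #Ш(W) +
# v_p Tam(W) − 2·ord_p #W(ℚ)_tors`, and the rank-one DescentGlue `KMC_p ∧ PR^× ⟹ BSD_p` IN HULL
# CURRENCY — no torsion-free member, no Mazur–Kenku walk, no image hypothesis
# (cell `bsd-potss`, seat `kmc`, generation 8; part 15b-i of the descent files: the READING)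

HONEST FRAMING (cell `bsd-potss`, `run/shared/lean/pub/bsd-potss/`, FULL-BSD rank-`≤ 1` programme
tranche 1b, rows B5 = O6 wild `3` (X3 r1 9 376 + X4 r1 5 348 S-b pairs), B4 (t′) r1, B8 = O7-ss;
routes `KatoDescentPotSupersingular` / `KatoDescentTamePotSupersingular`, residual items `WildRankOne`
(stmt-…-19200) / `TameRankOne` (stmt-…-19984)): NOTHING about Kato's objects or Perrin-Riou's
conjecture is asserted and no Literature fact is minted. As in parts 12–14 Kato's `Λ`-modules enter
through the interface `KatoHullDescentDatum p` + the interface predicate `IsHullOf`, the Perrin-Riou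
ratio through the interface predicate `PRRatio` (part 5), and the printed theorems about them as
HYPOTHESIS SCHEMATA with locators (§2). §4–§5 are CONDITIONAL over displayed readings / named facts
(audit `proof.conditional`); no route item or node is closed; census numbers are not inputs; nothing
is booked.

## The mathematics (memo v7 §2 of `HOME/bsd-potss-kmc/KMC-DESCENT-MEMO-v7.md`)

Let `p ≠ 2` be additive and potentially good for `E/ℚ` (member `W`, globally minimal; ANY image, ANY
rational torsion, `p^t = #E(ℚ)[p^∞]`), `ord_{s=1} L(E,s) = 1` (so `rank E(ℚ) = 1` and `Ш[p^∞]` is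
finite, Gross–Zagier–Kolyvagin), `x` a generator of `E(ℚ)/tors`, `T = T_pE`, `A = H¹(ℤ[1/p], j_*T)`
(Kato 8.2). Part 5's Reading 1″ (= Burns–Kurihara–Sano Thm. 7.3 / 7.8 (d) in Kato's normalisation) is
the count at `t = 0` — Burns–Kurihara–Sano's standing Hypothesis 2.2 (i) "`H¹(ℤ_S,T)` is `ℤ_p`-free"
(p. 9; §7 p. 29: "we always assume that `p` is odd and that `H¹(ℤ_S,T)` is `ℤ_p`-free") IS `t = 0`,
since `H¹(G_S,T)_tors = E(ℚ)[p^∞]`. At a member with `t > 0` (the X3 rows: a reducible `E[p]` usually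
comes with a rational `p`-torsion point somewhere in the class):
(F1) `B := H¹_f(ℚ,T)` (Kummer at `p`, no condition at `ℓ ≠ p` since `H¹(ℚ_ℓ,T)` is all Kummer) is
`lim Sel_{p^n}(E) = E(ℚ) ⊗ ℤ_p ≅ ℤ_p x ⊕ E(ℚ)[p^∞]` (`T_pШ = 0`); (F2) `A = {c ∈ B : loc_ℓ c ∈
H¹_ur(ℚ_ℓ,T) = κ(E₀(ℚ_ℓ) ⊗ ℤ_p) ∀ ℓ ≠ p} = ker(E(ℚ) ⊗ ℤ_p → ⊕_{ℓ≠p} Φ_ℓ(𝔽_ℓ)(p))`, of rank one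
with `A_tors` of order `p^{t₁}` (the rational `p`-power torsion on `E⁰(ℚ_ℓ)` at every `ℓ ≠ p`, part
14) and free part `Ā = p^{a′} ℤ_p x̄`, so `[B : A] = p^{a′ + t − t₁}`; (F3) every class of `A` is
Bloch–Kato-`f` at `p` (`A ⊗ ℚ = ℚ_p κ(x)`, `H¹_{/f}(ℚ_p,T)` torsion free), so (14.9.3) reads
`0 → H¹_{/f}(ℚ_p,T) → S(T)^∨ → H²(ℤ[1/p],T) → H²(ℚ_p,T) → E(ℚ)[p^∞]^∨ → 0` and
`#H²(ℤ[1/p],T) = #S_str(T) · p^{τ − t}` (`p^τ = #E(ℚ_p)[p^∞] = #H²(ℚ_p,T)`, `S_str` = Kato's `S(T)`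
made strict at `p`); (F4) `S_str/Sel_str ≅ S/Sel` (the Kummer line surjects onto
`H¹_f(ℚ_p,E[p^∞]) = E(ℚ_p) ⊗ ℚ_p/ℤ_p ≅ ℚ_p/ℤ_p`), `#Sel_str = p^ε · #Ш[p^∞]`
(`p^ε = [E(ℚ_p) ⊗ ℤ_p/tors : ℤ_p x]`), and Poitou–Tate for `Sel ⊂ S(T)` (Mazur–Rubin Thm. 2.3.4,
exact annihilators `H¹(ℚ_ℓ,T)` / `H¹_ur(ℚ_ℓ,T)`) gives `[S : Sel]·[B : A] = ∏_{ℓ≠p} c_ℓ^{(p)}`;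
(F5) Kato's generalized index of `z = λ·κ(x) ∈ A ⊗ ℚ` is `[A : z] = p^{t₁}·p^{v(λ) − a′}`; (F6) the
descent `[A : z] = p^m · #H²(ℤ[1/p],T)` (`p^m` = Kato's `μ`; `m = e(F/Λz) − e(𝐇²(T)⁰)` through the
hull, part 14a) gives — `a′` AND `t₁` CANCEL — `v(λ) = m + ε + τ + ord_p #Ш + Σ_{ℓ≠p} v_p c_ℓ − 2t`;
(F7) the additive local index `log_ω(E(ℚ_p) ⊗ ℤ_p) = p^{τ − v_p(c_p)} ℤ_p` (Kim AJM 2026 §3.2.3)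
gives `v(log_ω x) = ε + τ − v_p(c_p)`, and `ℒ := log_ω(loc_p z)/log_ω(x)² = λ/log_ω(x)`, so
**`v_p ℒ = m + ord_p #Ш[p^∞] + v_p Tam(E) − 2t`** at EVERY member. With PR^× (`v_p ℒ =
ord_p(L′(E,1)/(Ω·Reg))`) and `#Ш_an = (L′/(Ω·Reg))·#tors²/Tam` this is **`ord_p #Ш_an = ord_p #Ш + m`**
— the SAME defect identity as in analytic rank `0` (part 14), so: `KMC ∧ PR^× ⟹ BSD_p` and
`KMC ⟹ (BSD_p ⟺ PR^×)` at every hull-realised member; the UPPER half `ord_p #Ш ≤ ord_p #Ш_an`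
follows from PR^× and the divisibility for the hull alone (`m ≥ 0`; NO Main Conjecture — the rank-one
analogue of Thm. 14.5 (3)); and under Conj. 12.10 the zeta element automatically survives at the
bottom layer (`[A : y] ≠ 0`, i.e. Perrin-Riou's non-vanishing; Literature
`Kato2004.index_ne_zero_of_hull_of_lengthAt_eq`, part 15a).

## Contents (this file = part 15b-i; consequences in the siblings `KatoHullRankOneDescent.lean`
## (§4, at a realised member) and `PotGoodRankOneOfHullKMC.lean` (§5, the DescentGlue))
* §1 `KatoHullDescentDatum.yIndex_ne_zero_of_conj1210` (KMC ⇒ the zeta element survives; part 15a),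
  `muExp_eq_zero_of_conj1210'`.
* §2 READINGS (hypothesis schemata over the interface predicates; nothing asserted):
  `KatoHull.HasPRRatio PRRatio` (Reading M4♯: the ratio is defined, image-free),
  `KatoHull.RankOneExactCountReading IsHullOf PRRatio` (Reading M3♯-r1: the display above).
* §3 bookkeeping `L′/(Ω·Reg) ↔ #Ш_an` WITH the torsion term
  (`exists_shaAn_eq_of_leadingTerm_eq_torsion`, `exists_leadingTerm_eq_of_shaAn_eq_torsion`).

WHAT THIS IS NOT. Not a proof of `WildRankOne` / `TameRankOne` / `O7.PPartSS` (conditional over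
displayed readings and the two conjectures KMC, PR^×); not a construction of `𝐇^q(T)`, `z_γ`, the
hull, `H^q(ℤ[1/p],T)` or `ℒ` (interfaces; D-O6-2 stands, with "`PRRatio` realised"); not a proof of
Perrin-Riou's conjecture anywhere (a theorem only for `p ∤ 2N`, Burungale–Skinner–Tian–Wan Thm. 6.4);
nothing at `p = 2`, at a potentially multiplicative `p`, or in analytic rank `≠ 1`; nothing is booked.

References: K. Kato, Astérisque 295 (2004): 8.2 (p. 180), Thm. 12.4–12.6 (pp. 221–222), Conj. 12.10
(p. 224), 13.14 (p. 234), §14.1, Thm. 14.2, Thm. 14.5 and `[M : z]` (pp. 234–237), §14.8 (p. 238),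
(14.9.3) (p. 240), §14.14 and Lemma 14.15 (pp. 243–244), Prop. 14.16 (p. 244) [Kato2004Asterisque];
D. Burns, M. Kurihara, T. Sano, arXiv:1910.07404 = JMSJ: Hyp. 2.2 / Rem. 2.3 (p. 9), Conj. 2.8 (p. 10),
Thm. 7.3, Thm. 7.6, Rem. 7.7 (p. 29), Thm. 7.8 (d) (p. 30) [BurnsKuriharaSano2019]; B. Perrin-Riou,
Ann. Inst. Fourier 43 (1993) §3.3 [PerrinRiou1993AIF]; B. Mazur, K. Rubin, Mem. AMS 799 (2004) Thm.
2.3.4 [MazurRubin2004]; K. Rubin, *Euler Systems* Thm. 1.7.3, Prop. 1.4.3 [Rubin2000]; J. Coates, LNM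
1716 (1999) Lemmas 3.6, 3.8 [CoatesLNM1716]; R. Greenberg, LNM 1716 §3 [GreenbergLNM1716]; S. Bloch,
K. Kato, Grothendieck Festschrift I (1990) §3, Example 3.11 [BlochKato1990]; C.-H. Kim, AJM 148 (2026)
§3.2.3 [Kim2022StructureSelmer]; C. Wuthrich, Doc. Math. 19 (2014) §3.2–3.4 [Wuthrich2014];
J. W. S. Cassels, Crelle 217 (1965) [Cassels1965ArithmeticVIII]; R. L. Miller, LMS JCM 14 (2011)
Def. 1.1 [Miller2011LMS]; Burungale–Skinner–Tian–Wan arXiv:2409.01350 Thm. 6.4 [BurungaleSkinnerTianWan2024].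
-/

set_option autoImplicit false

noncomputable section

open scoped Classical

open WeierstrassCurve Literature.NumberTheory.EllipticCurves
  Literature.NumberTheory.EllipticCurves.ModularForms
  Literature.NumberTheory.EllipticCurves.Rank1Residual
  Literature.NumberTheory.EllipticCurves.Rank1Residual.Typed
  Literature.NumberTheory.EllipticCurves.IwasawaAlgebra

namespace Summit.BirchSwinnertonDyer.Rank1Residual.Additive

/-! ## §1 KMC ⇒ the zeta element survives at the bottom layer (kernel dictionary, part 15a) -/

namespace KatoHullDescentDatum

variable {p : ℕ} [Fact p.Prime] (D : KatoHullDescentDatum p)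

/-- **Conj. 12.10 on the hull and `H2/XH2` finite ⇒ `[A : y] ≠ 0`** — the zeta element survives at
the bottom layer (in analytic rank one: Perrin-Riou's non-vanishing, Burns–Kurihara–Sano Conj. 2.8
(i), is a CONSEQUENCE of Kato's Main Conjecture): `ℓ_{(T)}(F/Λz) = ℓ_{(T)}(𝐇²(T)⁰) = 0`, so
`(H/Λy)/T` is finite and `[A : y] = #H2[T]·#((H/Λy)/T) ≠ 0`
(`Kato2004.index_ne_zero_of_hull_of_lengthAt_eq`).
[cite: Kato2004Asterisque, Conj. 12.10 (p. 224), §14.14 and Lemma 14.15 (pp. 243–244)] [cite: BurnsKuriharaSano2019, Conj. 2.8 (i) (p. 10)] -/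
theorem yIndex_ne_zero_of_conj1210 (hMC : D.Conj1210) (hfin : Finite (coinvariants p D.H2)) :
    D.yIndex ≠ 0 :=
  Kato2004.index_ne_zero_of_hull_of_lengthAt_eq D.j D.j_injective D.finite_coker D.z
    D.isTorsion_quotient D.isTorsion_H2 hMC D.y D.e D.j_y D.ι D.π D.ι_injective D.π_surjective
    D.exact_ι_π hfin

/-- **Conj. 12.10 on the hull ⇒ `m = 0`**, with the survival hypothesis of part 14's
`muExp_eq_zero_of_conj1210` discharged. [cite: Kato2004Asterisque, Conj. 12.10 (p. 224), §14.14 (p. 243)] -/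
theorem muExp_eq_zero_of_conj1210' (hMC : D.Conj1210) (hfin : Finite (coinvariants p D.H2)) :
    D.muExp = 0 :=
  D.muExp_eq_zero_of_conj1210 hMC hfin (D.yIndex_ne_zero_of_conj1210 hMC hfin)

end KatoHullDescentDatum

/-! ## §2 The rank-one readings (hypothesis schemata over the interface predicates; nothing asserted) -/

namespace KatoHull

section Readings

variable (IsHullOf : ∀ (W : WeierstrassCurve ℚ) [W.IsElliptic] [W.IsGloballyMinimal] (p : ℕ)
  [Fact p.Prime], KatoHullDescentDatum p → Prop)
variable (PRRatio : ∀ (W : WeierstrassCurve ℚ) [W.IsElliptic] [W.IsGloballyMinimal] (p : ℕ)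
  [Fact p.Prime], ℚ_[p] → Prop)

/-- **READING M4♯ — the Perrin-Riou ratio `ℒ` is DEFINED in analytic rank one, at every member**
(image-free; rational torsion allowed). For `W/ℚ` globally minimal with `r_an = 1` and `p ≠ 2`
additive potentially good: `H¹(ℤ[1/p],T) ⊗ ℚ = H¹_f(ℚ,V) = ℚ_p κ(x)` (rank one, `Ш[p^∞]` finite by
Gross–Zagier–Kolyvagin; `x` a generator of `E(ℚ)/tors`), so the bottom layer `z` of the hull datum's
zeta element is `λ·κ(x)` with `λ ∈ ℚ_p`, `loc_p z ∈ H¹_f(ℚ_p,V)`, and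
`ℒ = log_ω(loc_p z)/log_ω(x)² = λ/log_ω(x)` exists (`log_ω(x) ≠ 0` for non-torsion `x`; `log_ω`
kills torsion, so `ℒ` does not depend on the choice of `x` modulo torsion). = part 5's `HasPRRatio`
with (12.5.2) dropped (Burns–Kurihara–Sano display (h1) p. 9 holds with `Ш[p^∞]` finite and
`r_alg > 0` only; their Hyp. 2.2 (i) is not needed to DEFINE `ℒ`). Hypothesis schema over the
interface `PRRatio`; nothing asserted.
[cite: BurnsKuriharaSano2019, display (h1) and Remark 2.3 (p. 9), Thm. 1.4 (p. 4)] [cite: Kato2004Asterisque, Thm. 12.6 (p. 222), 13.14 (p. 234)] -/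
def HasPRRatio : Prop :=
  ∀ (W : WeierstrassCurve ℚ) [W.IsElliptic] [W.IsGloballyMinimal] (p : ℕ) [Fact p.Prime],
    W.analyticRank = 1 → p ≠ 2 → Addv W p → 0 ≤ padicValRat p W.j → ∃ ℒ : ℚ_[p], PRRatio W p ℒ

/-- **READING M3♯-r1 — the EXACT rank-ONE count at an ARBITRARY member** (any image, any rational
torsion). For `W/ℚ` globally minimal of analytic rank `1`, `p ≠ 2` additive potentially good, `Ш(E)`
finite, a realised hull datum `D` of `W` and the Perrin-Riou ratio `ℒ` of (the bottom layer of) its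
zeta element, with `p^t = #W(ℚ)[p^∞]`: (i) `H²(ℤ[1/p],T) = 𝐇²(T)⁰/X` is finite; (ii) `ℒ ≠ 0 ⟺
[A : y] ≠ 0` (`y = p^e z`; both say `z` is non-torsion in `A ⊗ ℚ = ℚ_p κ(x)`, as `loc_p` and
`log_ω` are injective on the Kummer line); (iii) if `[A : y] ≠ 0` then
**`v_p(ℒ) + e + ord_p #H²(ℤ[1/p],T) + 2t = ord_p [A : y] + ord_p #Ш(E)(p) + v_p(Tam E)`**, i.e.
`v_p ℒ = m + ord_p #Ш + v_p Tam − 2t` with `p^m = [A : y]·p^{−e}/#H²(ℤ[1/p],T)` = Kato's `μ`.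
Derivation (memo v7 §2, F1–F7): (F1) `B = H¹_f(ℚ,T) = E(ℚ) ⊗ ℤ_p` (`T_pШ = 0`; Bloch–Kato Ex. 3.11
at `p`; at `ℓ ≠ p` `H¹(ℚ_ℓ,T) = E(ℚ_ℓ)(p)` is all Kummer); (F2) `A = ker(E(ℚ) ⊗ ℤ_p →
⊕_{ℓ≠p} Φ_ℓ(𝔽_ℓ)(p))` (Kato 8.2: `j_*`; `H¹_ur(ℚ_ℓ,T) = κ(E₀(ℚ_ℓ) ⊗ ℤ_p)`, Coates LNM 1716 Lemma
3.8), `#A_tors = p^{t₁}`, `Ā = p^{a′}ℤ_p x̄`, `[B : A] = p^{a′+t−t₁}`; (F3) `A` is Bloch–Kato-`f` at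
`p`, (14.9.3) and local duality give `#H²(ℤ[1/p],T) = #S_str(T)·p^{τ−t}`; (F4) `#S_str =
p^ε·#Ш[p^∞]·[S : Sel]`, `[S : Sel]·[B : A] = ∏_{ℓ≠p} c_ℓ^{(p)}` (Poitou–Tate for `Sel ⊂ S(T)`, Mazur–Rubin
Thm. 2.3.4, `#H¹_ur(ℚ_ℓ,E[p^∞]) = c_ℓ^{(p)}`, Greenberg §3); (F5) `[A : z] = p^{t₁ + v(λ) − a′}`
for `z = λκ(x)` (Kato's generalized index, p. 236); (F6) `[A : z] = p^m #H²` ⟹ `v(λ) = m + ε + τ +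
ord_p #Ш + Σ_{ℓ≠p} v_p c_ℓ − 2t` (`a′`, `t₁` cancel); (F7) `v(log_ω x) = ε + τ − v_p(c_p)` (the
additive local index, Kim §3.2.3: `log_ω(E(ℚ_p) ⊗ ℤ_p) = p^{τ − v_p(c_p)}ℤ_p`) and `ℒ = λ/log_ω(x)`.
At `t = 0` (iii) is part 5's Reading 1″ = Burns–Kurihara–Sano Thm. 7.3 / 7.8 (d) (`r = 1`, Kato's
normalisation); their standing Hyp. 2.2 (i) "`H¹(ℤ_S,T)` is `ℤ_p`-free" (p. 9; §7 p. 29) IS `t = 0`.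
Hypothesis schema; nothing asserted; every input printed (no conjecture inside).
[cite: Kato2004Asterisque, 8.2 (p. 180), Thm. 14.2 and §14.1 (pp. 234–235), `[M : z]` (pp. 236–237), (14.9.3) (p. 240), §14.8 (p. 238), §14.14 (pp. 243–244), Thm. 12.5 (1) (p. 221)]
[cite: BurnsKuriharaSano2019, Hyp. 2.2 and Remark 2.3 (p. 9), Thm. 7.3 (p. 29), Thm. 7.8 (d) (p. 30), Remark 1.7 (i) (p. 5)]
[cite: MazurRubin2004, Thm. 2.3.4] [cite: Rubin2000, Thm. 1.7.3 and Prop. 1.4.3]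
[cite: CoatesLNM1716, Lemma 3.6 with proof (pp. 32–33) and Lemma 3.8 (p. 34)] [cite: GreenbergLNM1716, §3 after Lemma 3.3]
[cite: BlochKato1990, §3, Example 3.11] [cite: Kim2022StructureSelmer, §3.2.3 display before Thm. 3.7 (PDF p. 16)] -/
def RankOneExactCountReading : Prop :=
  ∀ (W : WeierstrassCurve ℚ) [W.IsElliptic] [W.IsGloballyMinimal] (p : ℕ) [Fact p.Prime]
    (D : KatoHullDescentDatum p) (ℒ : ℚ_[p]),
    W.analyticRank = 1 → p ≠ 2 → Addv W p → 0 ≤ padicValRat p W.j →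
    Finite W.sha → IsHullOf W p D → PRRatio W p ℒ →
    Finite (coinvariants p D.H2) ∧ (ℒ ≠ 0 ↔ D.yIndex ≠ 0) ∧
      (D.yIndex ≠ 0 →
        ℒ.valuation + D.e + padicValNat p D.h2Card + 2 * (padicValNat p W.torsionOrder : ℤ) =
          (padicValNat p D.yIndex : ℤ) +
            padicValNat p (Nat.card (AddCommGroup.primaryComponent W.sha p)) +
            padicValNat p W.tamagawaProduct)

end Readings

end KatoHull

/-! ## §3 Bookkeeping `L′/(Ω·Reg) ↔ #Ш_an` with the torsion term -/

section Bookkeeping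

variable (W : WeierstrassCurve ℚ) [W.IsElliptic] (p : ℕ) [Fact p.Prime]

/-- **From `L^{(r)}(W,1)/(r!·Ω·Reg) = q` to `#Ш_an = q·#tors²/Tam` with
`ord_p #Ш_an = ord_p q + 2·ord_p #tors − ord_p Tam`** (`q ≠ 0` because the leading coefficient is
non-zero). Bookkeeping; the torsion term is KEPT (contrast part 5's `exists_shaAn_eq_of_leadingTerm_eq`
under irr(p)). [cite: Miller2011LMS, Def. 1.1 (arXiv:1010.2431 p. 3)] [cite: Mazur1977, Ch. III §5, p. 157] -/
theorem exists_shaAn_eq_of_leadingTerm_eq_torsion (hL : W.leadingLCoeff ≠ 0) {q : ℚ}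
    (hq : W.leadingLCoeff / ((W.realPeriodRat : ℂ) * (W.regulator : ℂ)) = (q : ℂ)) :
    ∃ q' : ℚ, shaAn W = (q' : ℂ) ∧
      padicValRat p q' = padicValRat p q + 2 * (padicValNat p W.torsionOrder : ℤ) -
        padicValNat p W.tamagawaProduct := by
  have hΩ : (W.realPeriodRat : ℂ) ≠ 0 := by exact_mod_cast W.realPeriodRat_pos_holds.ne'
  have hR : (W.regulator : ℂ) ≠ 0 := by exact_mod_cast W.regulator_pos'.ne'
  have hc0 : 0 < W.tamagawaProduct := W.tamagawaProduct_pos_holds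
  have ht0 : 0 < W.torsionOrder := W.torsionOrder_pos_holds
  have hq0 : q ≠ 0 := by
    rintro rfl
    rw [Rat.cast_zero, div_eq_zero_iff] at hq
    exact hq.elim hL (mul_ne_zero hΩ hR)
  refine ⟨q * (W.torsionOrder : ℚ) ^ 2 / (W.tamagawaProduct : ℚ), ?_, ?_⟩
  · have hLq : W.leadingLCoeff = (q : ℂ) * ((W.realPeriodRat : ℂ) * (W.regulator : ℂ)) := by
      rw [← hq, div_mul_cancel₀ _ (mul_ne_zero hΩ hR)]
    rw [shaAn_def, hLq]
    push_cast
    field_simp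
  · have ht : (W.torsionOrder : ℚ) ≠ 0 := by exact_mod_cast ht0.ne'
    have hcq : (W.tamagawaProduct : ℚ) ≠ 0 := by exact_mod_cast hc0.ne'
    rw [padicValRat.div (mul_ne_zero hq0 (pow_ne_zero 2 ht)) hcq,
      padicValRat.mul hq0 (pow_ne_zero 2 ht), pow_two, padicValRat.mul ht ht,
      padicValRat.of_nat, padicValRat.of_nat]
    ring

/-- **Conversely, from `#Ш_an = q'` to `L^{(r)}(W,1)/(r!·Ω·Reg) = q'·Tam/#tors²` with
`ord_p = ord_p q' + ord_p Tam − 2·ord_p #tors`** (`q' ≠ 0`). Bookkeeping, torsion term kept.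
[cite: Miller2011LMS, Def. 1.1 (arXiv:1010.2431 p. 3)] [cite: Mazur1977, Ch. III §5, p. 157] -/
theorem exists_leadingTerm_eq_of_shaAn_eq_torsion (hL : W.leadingLCoeff ≠ 0) {q' : ℚ}
    (hq' : shaAn W = (q' : ℂ)) :
    ∃ q : ℚ, W.leadingLCoeff / ((W.realPeriodRat : ℂ) * (W.regulator : ℂ)) = (q : ℂ) ∧
      padicValRat p q = padicValRat p q' + padicValNat p W.tamagawaProduct -
        2 * (padicValNat p W.torsionOrder : ℤ) := by
  have hΩ : (W.realPeriodRat : ℂ) ≠ 0 := by exact_mod_cast W.realPeriodRat_pos_holds.ne'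
  have hR : (W.regulator : ℂ) ≠ 0 := by exact_mod_cast W.regulator_pos'.ne'
  have hc0 : 0 < W.tamagawaProduct := W.tamagawaProduct_pos_holds
  have ht0 : 0 < W.torsionOrder := W.torsionOrder_pos_holds
  have hcC : (W.tamagawaProduct : ℂ) ≠ 0 := by exact_mod_cast hc0.ne'
  have htC : (W.torsionOrder : ℂ) ≠ 0 := by exact_mod_cast ht0.ne'
  have hq0 : q' ≠ 0 := by
    rintro rfl
    rw [Rat.cast_zero, shaAn_def, div_eq_zero_iff] at hq'
    rcases hq' with h | h
    · exact (mul_ne_zero hL (pow_ne_zero 2 htC)) h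
    · exact (mul_ne_zero (mul_ne_zero hΩ hcC) hR) h
  refine ⟨q' * (W.tamagawaProduct : ℚ) / (W.torsionOrder : ℚ) ^ 2, ?_, ?_⟩
  · rw [shaAn_def, div_eq_iff (mul_ne_zero (mul_ne_zero hΩ hcC) hR)] at hq'
    rw [div_eq_iff (mul_ne_zero hΩ hR)]
    have key : W.leadingLCoeff * (W.torsionOrder : ℂ) ^ 2 =
        ((q' * (W.tamagawaProduct : ℚ) / (W.torsionOrder : ℚ) ^ 2 : ℚ) : ℂ) *
          ((W.realPeriodRat : ℂ) * (W.regulator : ℂ)) * (W.torsionOrder : ℂ) ^ 2 := by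
      rw [hq']
      push_cast
      field_simp
    exact mul_right_cancel₀ (pow_ne_zero 2 htC) key
  · have ht : (W.torsionOrder : ℚ) ≠ 0 := by exact_mod_cast ht0.ne'
    have hcq : (W.tamagawaProduct : ℚ) ≠ 0 := by exact_mod_cast hc0.ne'
    rw [padicValRat.div (mul_ne_zero hq0 hcq) (pow_ne_zero 2 ht), padicValRat.mul hq0 hcq,
      pow_two, padicValRat.mul ht ht, padicValRat.of_nat, padicValRat.of_nat]
    ring

omit [W.IsElliptic] in
/-- `ord_p #Ш(E)(p) = ord_p #Ш(E)` for finite `Ш` (the `p`-primary component carries the `p`-part;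
restated under a fresh name because the sibling files' copies are `private`). [folklore] -/
theorem KatoHull.padicValNat_primaryComponent_sha (hfin : Finite W.sha) :
    padicValNat p (Nat.card (AddCommGroup.primaryComponent W.sha p)) = padicValNat p W.shaOrder := by
  haveI := hfin
  unfold WeierstrassCurve.shaOrder
  exact padicValNat_card_addPrimaryComponent p

end Bookkeeping

end Summit.BirchSwinnertonDyer.Rank1Residual.Additive

end
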